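import Mathlib
import HarnessLib
import Literature.Probability.MarkovChains.QMatrix

/-!
# The reversed process: rates `q'(j,k) = π(k)q(k,j)/π(j)`, and Kelly's lemma for transition rates (Kelly, Theorems 1.12–1.13; Brémaud, Theorem 7.4.16)

HONEST FRAMING: exact (Metropolis-corrected) sampling algorithms for lattice gauge theory; figures
of merit are autocorrelation/cost numbers at stated couplings and volumes; no continuum-physics claim.

Sources: F. P. Kelly, *Reversibility and Stochastic Networks*, Wiley 1979 (CUP 2011) [Kelly1979],
§1.7 "Reversed processes", Theorem 1.12 (the reversed process of a stationary Markov process has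
transition rates `q'(j,k) = π(k)q(k,j)/π(j)` and the same equilibrium distribution; "It follows from
Theorem 1.12 that `q(j) = q'(j)`") and Theorem 1.13 (Kelly's lemma: (1.27) `q'(j) = q(j)` and
(1.28) `π(j)q(j,k) = π(k)q'(k,j)` with `π > 0` summing to one ⇒ `π` is the equilibrium distribution
of both processes and `q'` are the reversed rates; proof: "`Σ_j π(j)q(j,k) = π(k)Σ_j q'(k,j) =
π(k)q'(k) = π(k)q(k)`"); P. Brémaud, *Probability Theory and Stochastic Processes*, Springer 2020
[Bremaud2020], §7.4.1 eqs. (7.52)–(7.53) (`π(i)p̃_ij(t) = π(j)p_ji(t)`, `π(i)q̃_ij = π(j)q_ji`) and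
Theorem 7.4.16 (the reversal test: `Σ_{j≠i} q̃_ij = q_i` for all `i` ⇒ `πᵀA = 0`).  The tree has the
DISCRETE-TIME reading of Theorem 1.13 (`KellyReversedChainLemma.lean`, whose docstring lists
"continuous time" as not claimed); this file is the printed transition-RATE version, in the
vocabulary of `QMatrix.lean` (`IsQMatrix`, `exitRate Q j = q(j)`, `IsInvariantQ π Q` (`πQ = 0`),
`ctSemigroup Q t = e^{tQ}`).  Everything is PROVED (0 named facts); finite state space.

* `reversedGenerator π Q j k = π(k)q(k,j)/π(j)` — the rates of the reversed process
  [cite: Kelly1979, §1.7 Thm 1.12]; [cite: Bremaud2020, eq. (7.53)];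
* `exitRate_reversedGenerator` — `q'(j) = q(j)` [cite: Kelly1979, §1.7 (remark after Thm 1.12)];
* `reversedGenerator_isQMatrix`, `isInvariantQ_reversedGenerator` — for `π` invariant and positive,
  `q'` is again a (stable, conservative) generator with the same equilibrium distribution ("it is
  worth checking that the equilibrium equations `π(j)Σ_k q'(j,k) = Σ_k π(k)q'(k,j)` are satisfied")
  [cite: Kelly1979, §1.7 Thm 1.12];
* **THEOREM 1.12, semigroup level** `Kelly1979_thm_1_12_ctSemigroup` — `π(j)p'_{jk}(t) = π(k)p_{kj}(t)`:
  the semigroup generated by the reversed rates is the time reversal of `P(t) = e^{tQ}`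
  [cite: Kelly1979, §1.7 Thm 1.12]; [cite: Bremaud2020, eqs. (7.52)–(7.53) ("as differentiation in
  (7.52) immediately shows" — here the converse integration, by `e^{D⁻¹(tQ)ᵀD} = D⁻¹(e^{tQ})ᵀD`)];
* **THEOREM 1.13 (Kelly's lemma, rates)** `Kelly1979_thm_1_13_rates` — generators `Q, Q'` with
  `q'(j) = q(j)` (1.27) and `π(j)q(j,k) = π(k)q'(k,j)` for `j ≠ k` (1.28), `π` nowhere zero ⇒
  `πQ = 0`, `πQ' = 0` and `Q' = reversedGenerator π Q` [cite: Kelly1979, §1.7 Thm 1.13];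
* **THEOREM 7.4.16 (Brémaud's reversal test)** `Bremaud2020_thm_7_4_16` — with `q̃` DEFINED by
  (7.53), `Σ_{j≠i} q̃_ij = q_i` for all `i` ⇒ `πᵀA = 0` [cite: Bremaud2020, Thm 7.4.16];
* **THEOREM 1.14 (equilibrium part)** `Kelly1979_thm_1_14_isInvariantQ` — for an involution
  `j ↦ j⁺` with `q(j) = q(j⁺)`: `π(j) = π(j⁺)` (1.29) and `π(j)q(j,k) = π(k⁺)q(k⁺,j⁺)` (1.30) ⇒
  `πQ = 0`, and `q(j⁺,k⁺)` are the reversed rates (`Kelly1979_thm_1_14_eq_reversedGenerator`)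
  [cite: Kelly1979, §1.7 Thm 1.14] (the tree's `SkewDetailedBalance.lean` is the discrete-time
  analogue).

NOT CLAIMED: the pathwise identification of `X(τ − t)` as a Markov process with these rates
(Theorem 1.12's first assertion is about the law of the reversed path; here only its generator and
semigroup), the "only if" half of Theorem 1.14 (a pathwise statement), countable state spaces.

Context (cell pub-lqcd, venture LatticeQCDFlow): the standard stationarity certificate for
NON-reversible continuous-time (event-chain, lifted) samplers — guess the reversed rates, check the
exit rates and `π(j)q(j,k) = π(k)q'(k,j)` entrywise; no global balance sum is ever evaluated.
-/

namespace Literature.Probability.MarkovChains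

open Finset Matrix NormedSpace

variable {I : Type*} [Fintype I] [DecidableEq I] {π : I → ℝ} {Q Q' : I → I → ℝ}

/-! ## Theorem 1.12: the reversed rates -/

/-- The transition rates of the reversed process: `q'(j,k) = π(k)q(k,j)/π(j)`.
[cite: Kelly1979, §1.7 Thm 1.12] [cite: Bremaud2020, eq. (7.53) (`π(i)q̃_ij = π(j)q_ji`)] -/
noncomputable def reversedGenerator (π : I → ℝ) (Q : I → I → ℝ) : I → I → ℝ :=
  fun j k => π k * Q k j / π j

omit [Fintype I] [DecidableEq I] in
/-- Entries of the reversed generator. [cite: Kelly1979, §1.7 Thm 1.12] -/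
theorem reversedGenerator_apply (π : I → ℝ) (Q : I → I → ℝ) (j k : I) :
    reversedGenerator π Q j k = π k * Q k j / π j := rfl

omit [Fintype I] [DecidableEq I] in
/-- The diagonal is unchanged: `q'(j,j) = q(j,j)` (`π(j) ≠ 0`). [cite: Kelly1979, §1.7 (after
Thm 1.12: "`q(j) = q'(j)`")] -/
theorem reversedGenerator_apply_self {j : I} (hπ : π j ≠ 0) : reversedGenerator π Q j j = Q j j := by
  rw [reversedGenerator_apply, mul_comm, mul_div_assoc, div_self hπ, mul_one]

omit [Fintype I] [DecidableEq I] in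
/-- **`q'(j) = q(j)`**: "the periods spent in state `j` have the same distribution whatever the
direction of time". [cite: Kelly1979, §1.7 (remark after Thm 1.12)] -/
theorem exitRate_reversedGenerator {j : I} (hπ : π j ≠ 0) :
    exitRate (reversedGenerator π Q) j = exitRate Q j := by
  rw [exitRate, exitRate, reversedGenerator_apply_self hπ]

omit [Fintype I] [DecidableEq I] in
/-- (1.28) holds between `Q` and its reversed rates: `π(j)q(j,k) = π(k)q'(k,j)` (`π(k) ≠ 0`).
[cite: Kelly1979, §1.7 Thm 1.13 eq. (1.28) with Thm 1.12] -/
theorem mul_eq_mul_reversedGenerator {k : I} (hπ : π k ≠ 0) (j : I) :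
    π j * Q j k = π k * reversedGenerator π Q k j := by
  rw [reversedGenerator_apply, mul_div_cancel₀ _ hπ]

omit [DecidableEq I] in
/-- For `π` positive and invariant (`πQ = 0`), the reversed rates form a generator (off-diagonal
entries `≥ 0`, zero row sums: `Σ_k π(k)q(k,j)/π(j) = (πQ)_j/π(j) = 0`). [cite: Kelly1979, §1.7
Thm 1.12 (the reversed process is a stationary Markov process)] -/
theorem reversedGenerator_isQMatrix (hQ : IsQMatrix Q) (hπ : ∀ i, 0 < π i) (hinv : IsInvariantQ π Q) :
    IsQMatrix (reversedGenerator π Q) := by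
  refine ⟨fun j k hjk => ?_, fun j => ?_⟩
  · rw [reversedGenerator_apply]
    exact div_nonneg (mul_nonneg (hπ k).le (hQ.1 k j (Ne.symm hjk))) (hπ j).le
  · simp_rw [reversedGenerator_apply]
    rw [← sum_div, hinv j, zero_div]

omit [DecidableEq I] in
/-- The reversed generator has the same equilibrium distribution: `πQ' = 0` ("it is worth checking
that the equilibrium equations `π(j)Σ_k q'(j,k) = Σ_k π(k)q'(k,j)` are satisfied":
`Σ_k π(k)q'(k,j) = π(j)Σ_k q(j,k) = 0`). [cite: Kelly1979, §1.7 Thm 1.12] -/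
theorem isInvariantQ_reversedGenerator (hQ : IsQMatrix Q) (hπ : ∀ i, π i ≠ 0) :
    IsInvariantQ π (reversedGenerator π Q) := by
  intro j
  calc ∑ k, π k * reversedGenerator π Q k j = ∑ k, π j * Q j k :=
        sum_congr rfl fun k _ => (mul_eq_mul_reversedGenerator (hπ k) j).symm
    _ = 0 := by rw [← mul_sum, hQ.2 j, mul_zero]

/-! ## Theorem 1.12 at the level of the semigroup: `π(j)p'_{jk}(t) = π(k)p_{kj}(t)` -/

/-- As a matrix, `Q' = D⁻¹ Qᵀ D` with `D = diag(π)` (`π` nowhere zero). [cite: Kelly1979, §1.7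
Thm 1.12] -/
theorem of_reversedGenerator_eq_conj (hπ : ∀ i, π i ≠ 0) :
    Matrix.of (reversedGenerator π Q) =
      diagonal (fun i => (π i)⁻¹) * (Matrix.of Q)ᵀ * diagonal π := by
  ext j k
  rw [mul_diagonal, diagonal_mul, transpose_apply, of_apply, of_apply, reversedGenerator_apply]
  field_simp [hπ j]

/-- `D = diag(π)` as a unit of the matrix ring, with inverse `diag(π⁻¹)`. [cite: Kelly1979, §1.7
Thm 1.12 (`π(j) > 0`)] -/
noncomputable def piDiagUnit (π : I → ℝ) (hπ : ∀ i, π i ≠ 0) : (Matrix I I ℝ)ˣ where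
  val := diagonal π
  inv := diagonal fun i => (π i)⁻¹
  val_inv := by
    rw [diagonal_mul_diagonal, ← diagonal_one]
    exact congrArg diagonal (funext fun i => mul_inv_cancel₀ (hπ i))
  inv_val := by
    rw [diagonal_mul_diagonal, ← diagonal_one]
    exact congrArg diagonal (funext fun i => inv_mul_cancel₀ (hπ i))

/-- **THEOREM 1.12 (semigroup level).**  With `P(t) = e^{tQ}` and `P'(t) = e^{tQ'}` for the reversed
rates `Q'`: `π(j) p'_{jk}(t) = π(k) p_{kj}(t)` for all `t` and all `j, k` — i.e.
`p'_{jk}(t) = π(k)p_{kj}(t)/π(j)`, the transition function of the reversed process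
(`e^{tD⁻¹QᵀD} = D⁻¹ (e^{tQ})ᵀ D`). [cite: Kelly1979, §1.7 Thm 1.12] [cite: Bremaud2020, §7.4.1
eqs. (7.52)–(7.53)] -/
theorem Kelly1979_thm_1_12_ctSemigroup (hπ : ∀ i, π i ≠ 0) (t : ℝ) (j k : I) :
    ctSemigroup (reversedGenerator π Q) t j k = π k * ctSemigroup Q t k j / π j := by
  have hconj : t • Matrix.of (reversedGenerator π Q) =
      (((piDiagUnit π hπ)⁻¹ : (Matrix I I ℝ)ˣ) : Matrix I I ℝ) * (t • Matrix.of Q)ᵀ *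
        ((piDiagUnit π hπ : (Matrix I I ℝ)ˣ) : Matrix I I ℝ) := by
    rw [of_reversedGenerator_eq_conj hπ, transpose_smul, mul_smul_comm, smul_mul_assoc]
    rfl
  rw [ctSemigroup_apply, ctSemigroup_apply, hconj, Matrix.exp_units_conj', Matrix.exp_transpose]
  show (diagonal (fun i => (π i)⁻¹) * (exp (t • Matrix.of Q))ᵀ * diagonal π) j k = _
  rw [mul_diagonal, diagonal_mul, transpose_apply]
  field_simp [hπ j]

/-! ## Theorem 1.13: Kelly's lemma for transition rates -/

/-- **THEOREM 1.13, equilibrium of `Q`.**  Generators `Q, Q'` with equal exit rates `q'(j) = q(j)`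
(1.27) and `π(j)q(j,k) = π(k)q'(k,j)` for `j ≠ k` (1.28) ⇒ `πQ = 0`:
"`Σ_j π(j)q(j,k) = π(k)Σ_j q'(k,j) = π(k)q'(k) = π(k)q(k)`". [cite: Kelly1979, §1.7 Thm 1.13] -/
theorem Kelly1979_thm_1_13_rates_isInvariantQ (hQ' : IsQMatrix Q')
    (h27 : ∀ j, exitRate Q' j = exitRate Q j) (h28 : ∀ j k, j ≠ k → π j * Q j k = π k * Q' k j) :
    IsInvariantQ π Q := by
  intro k
  rw [← add_sum_erase _ _ (mem_univ k)]
  have h1 : ∑ j ∈ univ.erase k, π j * Q j k = π k * exitRate Q' k := by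
    rw [exitRate_eq_sum_erase hQ' k, mul_sum]
    exact sum_congr rfl fun j hj => h28 j k (ne_of_mem_erase hj)
  rw [h1, h27 k, exitRate]
  ring

/-- **THEOREM 1.13, equilibrium of `Q'`** ("`π(j)` is the equilibrium distribution of both
processes"). [cite: Kelly1979, §1.7 Thm 1.13] -/
theorem Kelly1979_thm_1_13_rates_isInvariantQ' (hQ : IsQMatrix Q)
    (h27 : ∀ j, exitRate Q' j = exitRate Q j) (h28 : ∀ j k, j ≠ k → π j * Q j k = π k * Q' k j) :
    IsInvariantQ π Q' := by
  intro k
  rw [← add_sum_erase _ _ (mem_univ k)]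
  have h1 : ∑ j ∈ univ.erase k, π j * Q' j k = π k * exitRate Q k := by
    rw [exitRate_eq_sum_erase hQ k, mul_sum]
    exact sum_congr rfl fun j hj => (h28 k j (ne_of_mem_erase hj).symm).symm
  rw [h1, ← h27 k, exitRate]
  ring

omit [Fintype I] [DecidableEq I] in
/-- **THEOREM 1.13, identification of `q'`:** under (1.27)–(1.28) with `π` nowhere zero, `q'` IS
the collection of reversed rates of Theorem 1.12. [cite: Kelly1979, §1.7 Thm 1.13 ("That `q'(j,k)`
are the transition rates of the reversed process then follows from Theorem 1.12")] -/
theorem Kelly1979_thm_1_13_rates_eq (hπ : ∀ i, π i ≠ 0) (h27 : ∀ j, exitRate Q' j = exitRate Q j)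
    (h28 : ∀ j k, j ≠ k → π j * Q j k = π k * Q' k j) : Q' = reversedGenerator π Q := by
  funext j k
  by_cases hjk : j = k
  · subst hjk
    rw [reversedGenerator_apply_self (hπ j)]
    have := h27 j
    simp only [exitRate, neg_inj] at this
    exact this
  · rw [reversedGenerator_apply, eq_div_iff (hπ j), mul_comm, ← h28 k j (Ne.symm hjk)]

/-- **THEOREM 1.13 (Kelly's lemma for transition rates).**  Let `Q, Q'` be generators on the finite
state space with `q'(j) = q(j)` for all `j` (1.27), and `π` nowhere zero with
`π(j)q(j,k) = π(k)q'(k,j)` for all `j ≠ k` (1.28).  Then `π` is invariant for both (`πQ = 0 = πQ'`)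
and `q'(j,k) = π(k)q(k,j)/π(j)` are the reversed rates. [cite: Kelly1979, §1.7 Thm 1.13] -/
theorem Kelly1979_thm_1_13_rates (hQ : IsQMatrix Q) (hQ' : IsQMatrix Q') (hπ : ∀ i, π i ≠ 0)
    (h27 : ∀ j, exitRate Q' j = exitRate Q j) (h28 : ∀ j k, j ≠ k → π j * Q j k = π k * Q' k j) :
    IsInvariantQ π Q ∧ IsInvariantQ π Q' ∧ Q' = reversedGenerator π Q :=
  ⟨Kelly1979_thm_1_13_rates_isInvariantQ hQ' h27 h28,
    Kelly1979_thm_1_13_rates_isInvariantQ' hQ h27 h28, Kelly1979_thm_1_13_rates_eq hπ h27 h28⟩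

/-- **THEOREM 7.4.16 (Brémaud's reversal test).**  Let `A = (q_ij)` be a (stable, conservative)
generator and `π` a strictly positive vector; define `q̃_ij` by `π(i)q̃_ij = π(j)q_ji` (7.53).  If
`Σ_{j≠i} q̃_ij = q_i` for all `i` (7.55), then `πᵀA = 0`. [cite: Bremaud2020, Thm 7.4.16] -/
theorem Bremaud2020_thm_7_4_16 (hπ : ∀ i, 0 < π i)
    (h : ∀ i, ∑ j ∈ univ.erase i, reversedGenerator π Q i j = exitRate Q i) : IsInvariantQ π Q := by
  intro i
  have hi := h i
  simp_rw [reversedGenerator_apply] at hi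
  rw [← sum_div, div_eq_iff (hπ i).ne', exitRate] at hi
  rw [← add_sum_erase _ _ (mem_univ i), hi]
  ring

/-! ## Theorem 1.14: dynamic reversibility certifies the equilibrium distribution -/

omit [DecidableEq I] in
/-- Conjugating a generator by a bijection of the state space gives a generator:
`q'(j,k) = q(j⁺,k⁺)`. [cite: Kelly1979, §1.7 (dynamically reversible processes: "`[X(τ−t)]⁺`")] -/
theorem IsQMatrix.conj (hQ : IsQMatrix Q) {σ : I → I} (hσ : Function.Bijective σ) :
    IsQMatrix (fun j k => Q (σ j) (σ k)) := by
  refine ⟨fun j k hjk => hQ.1 _ _ fun h => hjk (hσ.1 h), fun j => ?_⟩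
  show ∑ k, Q (σ j) (σ k) = 0
  exact ((Equiv.ofBijective σ hσ).sum_comp (fun k => Q (σ j) k)).trans (hQ.2 (σ j))

/-- **THEOREM 1.14 (equilibrium part).**  Let the conjugation `j ↦ j⁺` be an involution of the
state space with `q(j) = q(j⁺)` for all `j`.  If positive numbers `π(j)` satisfy `π(j) = π(j⁺)`
(1.29) and `π(j)q(j,k) = π(k⁺)q(k⁺,j⁺)` (1.30), then `π` is the equilibrium distribution: `πQ = 0`
("When there exists such a collection `π(j)`, it is the equilibrium distribution of the process")
— by Theorem 1.13 with the candidate reversed rates `q'(j,k) = q(j⁺,k⁺)`. [cite: Kelly1979, §1.7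
Thm 1.14 (eqs. (1.29), (1.30))] -/
theorem Kelly1979_thm_1_14_isInvariantQ (hQ : IsQMatrix Q) {σ : I → I} (hσ : Function.Involutive σ)
    (hq : ∀ j, exitRate Q j = exitRate Q (σ j)) (h29 : ∀ j, π j = π (σ j))
    (h30 : ∀ j k, π j * Q j k = π (σ k) * Q (σ k) (σ j)) : IsInvariantQ π Q := by
  refine Kelly1979_thm_1_13_rates_isInvariantQ (Q' := fun j k => Q (σ j) (σ k))
    (hQ.conj hσ.bijective) (fun j => ?_) (fun j k _ => ?_)
  · show -Q (σ j) (σ j) = exitRate Q j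
    rw [hq j]; rfl
  · show π j * Q j k = π k * Q (σ k) (σ j)
    rw [h30 j k, ← h29 k]

omit [Fintype I] [DecidableEq I] in
/-- … and the conjugated rates `q(j⁺,k⁺)` are then the rates of the reversed process
(`= π(k)q(k,j)/π(j)`): the process is dynamically reversible. [cite: Kelly1979, §1.7 Thm 1.14 with
Thm 1.13] -/
theorem Kelly1979_thm_1_14_eq_reversedGenerator (hπ : ∀ i, π i ≠ 0) {σ : I → I}
    (hq : ∀ j, exitRate Q j = exitRate Q (σ j)) (h29 : ∀ j, π j = π (σ j))
    (h30 : ∀ j k, π j * Q j k = π (σ k) * Q (σ k) (σ j)) :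
    (fun j k => Q (σ j) (σ k)) = reversedGenerator π Q :=
  Kelly1979_thm_1_13_rates_eq hπ (fun j => by show -Q (σ j) (σ j) = exitRate Q j; rw [hq j]; rfl)
    (fun j k _ => by show π j * Q j k = π k * Q (σ k) (σ j); rw [h30 j k, ← h29 k])

end Literature.Probability.MarkovChains
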